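import Literature.Analysis.FluidPDE.LagrangianLatticeCarrier
import Literature.Analysis.FluidPDE.PassiveVectorTensorDistorted
import Summits.AnomalousDissipation.AnomalousDissipation.Theorems.SolenoidalFractalHomogenisationLagrangianStepDefs
import HarnessLib

/-!
# K1L_D `LagrangianRenormalisationStepDesign` (stmt-AnomalousDissipation-27980), stub `stub_windowDefectL` (S23′): the FRAME DEFINITIONS of the
# lead's sub-split S1′/S2′ (helper definitions; `--supports stmt-AnomalousDissipation-27980 --as helper`)

Summits-side definitions file of route `SolenoidalFractalHomogenisation` (objects the K1L line posits; no theorems, no named facts, no instances).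
It is §0 of the lead's sub-split `Cruxes/LagrangianRenormalisationStep/Lines/onelevel_S23_split.lean` (lead-k1l-onelevel-p1 g2, 2026-08-28) copied
VERBATIM — same short names, bodies and binder order — so that the sub-stubs S1′ `stub_conjugateL` (Lagrangian conjugation on one refresh window)
and S2′ `stub_distortedCellLawL` (the cell clauses survive the common distortion as a rate error), typed against ad-lit's distorted weak class
`Torus.IsWeakTensorPassiveVectorDistortedOn` (p645449), refer to TREE declarations (K1L SHARED-DEFS RULE):
* `frameJac E m t w y` — the Jacobian MATRIX `(∂_c X_a)(y)` of the coarse flow `E.X m t w`, read off the operator `E.flowDeriv m t w y`;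
* `frameG E m t w y := (frameJac E m t w y)⁻¹` — the inverse Jacobian, i.e. the distortion field `G` of the distorted class (Armstrong–Vicol's
  `∇X_{m−1}⁻¹`; junk value where singular, which it never is on a refresh window);
* `conjField E m w u s y := u s (E.X m (w+s) w y)` — the frame field of a field restarted at `w` (PLAIN composition; it satisfies the distorted
  constraint `div (frameG · conjField) = 0`, not `div = 0`);
* `residualCarrier E m m' w` — the pulled-back residual carrier of the levels `m+1, …, m′` in the frame of `b_{≤m}` (`= level (m+1) (w+·)` for
  `m′ = m+1` by `IsInserted`, `= 0` for `m′ = m`).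
This is NOT a proof of anything — in particular not of Onsager's conjecture nor of anomalous dissipation; rung F-D1.A0 vocabulary only.
-/

set_option linter.dupNamespace false

namespace Summit.AnomalousDissipation.AnomalousDissipation.Theorems.SolenoidalFractalHomogenisation.LagrangianStep

open Literature.Analysis Literature.Analysis.FluidPDE Literature.Analysis.FunctionSpaces

noncomputable section

/-- The Jacobian MATRIX `(∂_c X_a)(y)` of the coarse flow `E.X m t w` at `y`, read off the operator `E.flowDeriv m t w y`
(entry `(a, c)` = `a`-th coordinate of `flowDeriv` applied to the `c`-th basis vector). -/
def frameJac {k : ℕ} (E : LatticeShear.LagrangianLatticeCarrier k) (m : ℕ) (t w : ℝ) (y : UnitAddTorus (Fin 3)) :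
    Matrix (Fin 3) (Fin 3) ℝ :=
  Matrix.of fun a c => (E.flowDeriv m t w y (EuclideanSpace.single c 1)) a

/-- The INVERSE Jacobian matrix `G = (∇X)⁻¹` of the coarse flow — the distortion field of `Torus.IsWeakTensorPassiveVectorDistortedOn`
(junk value where singular; on a refresh window it is within `O(strain)` of the identity). -/
def frameG {k : ℕ} (E : LatticeShear.LagrangianLatticeCarrier k) (m : ℕ) (t w : ℝ) (y : UnitAddTorus (Fin 3)) :
    Matrix (Fin 3) (Fin 3) ℝ :=
  (frameJac E m t w y)⁻¹

/-- The FRAME FIELD of a time-dependent field restarted at `w`: `û s y := u s (X_m(w+s, w) y)` (plain composition, window time `s`). -/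
def conjField {k : ℕ} (E : LatticeShear.LagrangianLatticeCarrier k) (m : ℕ) (w : ℝ) (u : ℝ → VF) : ℝ → VF :=
  fun s y => u s (E.X m (w + s) w y)

/-- The pulled-back RESIDUAL CARRIER of the levels `m+1, …, m′` in the frame of `b_{≤m}`:
`ĉ s y := G(s,y) · (partialSum m′ − partialSum m)(w+s, X(s) y)` (`= level (m+1) (w+s) y` for `m′ = m+1` by `IsInserted`, `= 0` for `m′ = m`). -/
def residualCarrier {k : ℕ} (E : LatticeShear.LagrangianLatticeCarrier k) (m m' : ℕ) (w : ℝ) : ℝ → VF :=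
  fun s => Torus.distort (frameG E m (w + s) w)
    (fun y => E.partialSum m' (w + s) (E.X m (w + s) w y) - E.partialSum m (w + s) (E.X m (w + s) w y))

end

end Summit.AnomalousDissipation.AnomalousDissipation.Theorems.SolenoidalFractalHomogenisation.LagrangianStep
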